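import Summits.KontsevichZagierPeriods.KontsevichZagierPeriods.Theorems.SoloBlindSecondSemialgebraic
import Summits.KontsevichZagierPeriods.KontsevichZagierPeriods.Theorems.SoloBlindSecondIntegrable
import Summits.KontsevichZagierPeriods.KontsevichZagierPeriods.Theorems.SoloBlindSecondTraces
import Summits.KontsevichZagierPeriods.KontsevichZagierPeriods.Theorems.SoloBlindCyclicBeta
import HarnessLib

/-!
# The second-kind Green datum and its pair trick

For level-`N` data `(k, l)` with `k, l < N < k + l` — i.e. `a = k/N`, `b = l/N` in `(0,1)` with
`1 < a + b < 2`, the range where `β(a,b)` itself diverges as a real half-line integral of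
`(-x)^{a-1}(1-x)^{b-1}` — the corrected form

  `g(z) = z^α (1-z)^β - λ z^σ - μ (1-z)^σ`,  `α = a-1`, `β = b-1`, `σ = α+β`,
  `λ = sin(πα)/sin(πσ)`, `μ = sin(πβ)/sin(πσ)`  (real algebraic),

is a Green datum on `D = {x < ½, y > 0}` (`SoloBlindGreenDatum`): the real counterterm kills the
`z^σ` head of `g` at infinity (`SoloBlindSecondAsymp`), keeps the conjugation symmetry on the
axis `x = ½` under `(k,l,λ,μ) ↦ (l,k,μ,λ)`, and keeps the edge trace real on `(0,½)`.  Hence, as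
in the first kind (`SoloBlindCyclicGreen`), the edge representations of `(k,l)` and `(l,k)` on
`(-∞,0)` are congruent modulo the Kontsevich–Zagier relations.

References: Kontsevich–Zagier, *Periods* (2001), §1.2; Whittaker–Watson, §12.43 (Pochhammer's
regularisation, here replaced by a counterterm inside the rules).
-/

noncomputable section

open Set Complex MeasureTheory Filter
open scoped Topology
open Literature.ModelTheory.ExponentialFields MvPolynomial
open Literature.NumberTheory.Transcendental
open Literature.NumberTheory.Transcendental.KZ

namespace Summit.KontsevichZagierPeriods.KontsevichZagierPeriods.Theorems

namespace SoloBlind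

/-- Level-`N` second-kind data: exponents `k/N - 1`, `l/N - 1` with `k, l < N < k + l`. -/
structure SecData where
  /-- the level -/
  N : ℕ
  /-- numerator of `a = k/N` -/
  k : ℕ
  /-- numerator of `b = l/N` -/
  l : ℕ
  hkN : k < N
  hlN : l < N
  hsum : N < k + l

namespace SecData

variable (d : SecData)

/-- `1 < k < N`, hence `2 ≤ N` (level at least two). -/
theorem secLevel_two_le : 1 < d.k ∧ 2 ≤ d.N := by
  have := d.hkN; have := d.hlN; have := d.hsum; omega

/-- `k ≥ 1`. -/
theorem k_pos : 0 < d.k := by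
  have := d.hlN; have := d.hsum; omega

/-- `l ≥ 1`. -/
theorem l_pos : 0 < d.l := by
  have := d.hkN; have := d.hsum; omega

/-- The exponent inequalities: `α, β, σ = α + β ∈ (-1, 0)`. -/
theorem exp_bounds :
    (-1 < cycExp d.N d.k ∧ cycExp d.N d.k < 0) ∧ (-1 < cycExp d.N d.l ∧ cycExp d.N d.l < 0) ∧
      (-1 < cycExp d.N d.k + cycExp d.N d.l ∧ cycExp d.N d.k + cycExp d.N d.l < 0) := by
  have hN : (0 : ℝ) < d.N := by
    have h : 0 < d.N := lt_of_le_of_lt (Nat.zero_le _) d.hkN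
    exact_mod_cast h
  have hk : (0 : ℝ) < d.k := by exact_mod_cast d.k_pos
  have hl : (0 : ℝ) < d.l := by exact_mod_cast d.l_pos
  have hkN : (d.k : ℝ) < d.N := by exact_mod_cast d.hkN
  have hlN : (d.l : ℝ) < d.N := by exact_mod_cast d.hlN
  have hsum : (d.N : ℝ) < d.k + d.l := by exact_mod_cast d.hsum
  simp only [cycExp]
  have h1 : (d.k : ℝ) / d.N < 1 := (div_lt_one hN).mpr hkN
  have h2 : (d.l : ℝ) / d.N < 1 := (div_lt_one hN).mpr hlN
  have h3 : 1 < (d.k : ℝ) / d.N + d.l / d.N := by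
    rw [← add_div, one_lt_div hN]; exact hsum
  refine ⟨⟨by linarith [div_pos hk hN], by linarith⟩, ⟨by linarith [div_pos hl hN], by linarith⟩,
    by linarith, by linarith⟩

/-- `sin(πσ) ≠ 0` (indeed `< 0`). -/
theorem sin_sigma_ne : Real.sin (Real.pi * (cycExp d.N d.k + cycExp d.N d.l)) ≠ 0 := by
  have h := d.exp_bounds.2.2
  refine (Real.sin_neg_of_neg_of_neg_pi_lt (by nlinarith [Real.pi_pos]) ?_).ne
  nlinarith [Real.pi_pos]

/-- The counterterm coefficient `λ = sin(πα)/sin(πσ)`. -/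
def lam : ℝ :=
  Real.sin (Real.pi * cycExp d.N d.k) / Real.sin (Real.pi * (cycExp d.N d.k + cycExp d.N d.l))

/-- The counterterm coefficient `μ = sin(πβ)/sin(πσ)`. -/
def mu : ℝ :=
  Real.sin (Real.pi * cycExp d.N d.l) / Real.sin (Real.pi * (cycExp d.N d.k + cycExp d.N d.l))

/-- **(H1)** `λ + μ cos(πσ) = cos(πβ)`. -/
theorem H1 : d.lam + d.mu * Real.cos (Real.pi * (cycExp d.N d.k + cycExp d.N d.l)) =
    Real.cos (Real.pi * cycExp d.N d.l) := by
  have hs := d.sin_sigma_ne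
  have key : Real.sin (Real.pi * cycExp d.N d.k) =
      Real.sin (Real.pi * (cycExp d.N d.k + cycExp d.N d.l)) * Real.cos (Real.pi * cycExp d.N d.l) -
        Real.cos (Real.pi * (cycExp d.N d.k + cycExp d.N d.l)) *
          Real.sin (Real.pi * cycExp d.N d.l) := by
    rw [← Real.sin_sub]; congr 1; ring
  rw [lam, mu, key]
  field_simp
  ring

/-- **(H2)** `μ sin(πσ) = sin(πβ)`. -/
theorem H2 : d.mu * Real.sin (Real.pi * (cycExp d.N d.k + cycExp d.N d.l)) =
    Real.sin (Real.pi * cycExp d.N d.l) := by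
  rw [mu, div_mul_cancel₀ _ d.sin_sigma_ne]

/-- The cancellation condition at infinity. -/
theorem hK : ephase (cycExp d.N d.l) - d.lam - d.mu * ephase (cycExp d.N d.k + cycExp d.N d.l) =
    0 :=
  ephase_rel d.H1 d.H2

/-- `λ sin(πσ) = sin(πα)`. -/
theorem hl_rel : d.lam * Real.sin (Real.pi * (cycExp d.N d.k + cycExp d.N d.l)) =
    Real.sin (Real.pi * cycExp d.N d.k) := by
  rw [lam, div_mul_cancel₀ _ d.sin_sigma_ne]

/-- `sin(π(k/N - 1))` is real algebraic. -/
theorem isAlgebraic_sin_cycExp (N k : ℕ) : IsAlgebraic ℚ (Real.sin (Real.pi * cycExp N k)) := by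
  rw [sin_pi_mul_cycExp]; exact (isAlgebraic_sinFrac N k).neg

/-- `sin(πσ)` is real algebraic. -/
theorem isAlgebraic_sin_sigma (N k l : ℕ) :
    IsAlgebraic ℚ (Real.sin (Real.pi * (cycExp N k + cycExp N l))) := by
  rw [cycExp_add, mul_sub, mul_one, Real.sin_sub_pi, sin_pi_mul_cycExp, neg_neg]
  exact isAlgebraic_sinFrac N (k + l)

/-- `λ` is real algebraic. -/
theorem isAlgebraic_lam : IsAlgebraic ℚ d.lam :=
  mem_K₀_iff.mp (div_mem (mem_K₀_iff.mpr (isAlgebraic_sin_cycExp d.N d.k))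
    (mem_K₀_iff.mpr (isAlgebraic_sin_sigma d.N d.k d.l)))

/-- `μ` is real algebraic. -/
theorem isAlgebraic_mu : IsAlgebraic ℚ d.mu :=
  mem_K₀_iff.mp (div_mem (mem_K₀_iff.mpr (isAlgebraic_sin_cycExp d.N d.l))
    (mem_K₀_iff.mpr (isAlgebraic_sin_sigma d.N d.k d.l)))

/-- The swapped data `(l, k)`. -/
def swap : SecData := ⟨d.N, d.l, d.k, d.hlN, d.hkN, by rw [add_comm]; exact d.hsum⟩

/-- `λ(l,k) = μ(k,l)`. -/
theorem swap_lam : d.swap.lam = d.mu := by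
  simp only [lam, mu, swap]; rw [add_comm]

/-- `μ(l,k) = λ(k,l)`. -/
theorem swap_mu : d.swap.mu = d.lam := by
  simp only [lam, mu, swap]; rw [add_comm]

/-- **The second-kind Green datum**: `g = z^α(1-z)^β - λ z^σ - μ (1-z)^σ`. -/
def datum : GreenDatum where
  g := gK (cycExp d.N d.k) (cycExp d.N d.l) d.lam d.mu
  g' := gKDer (cycExp d.N d.k) (cycExp d.N d.l) d.lam d.mu
  hasDerivAt := fun _ _ _ hy =>
    hasDerivAt_gK _ _ _ _ (mem_slitPlane_pair hy).1 (mem_slitPlane_pair hy).2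
  cwa := fun _ hx hx0 => continuousWithinAt_gK _ _ _ _ hx hx0
  sa_re := (sa_gK d.secLevel_two_le.2 d.k d.l d.isAlgebraic_lam d.isAlgebraic_mu).1
  sa_im := (sa_gK d.secLevel_two_le.2 d.k d.l d.isAlgebraic_lam d.isAlgebraic_mu).2
  sa_h := sa_re_gKDer d.secLevel_two_le.2 d.k d.l d.isAlgebraic_lam d.isAlgebraic_mu
  integrableOn_h := integrableOn_re_gKDer d.exp_bounds.1.1.le d.exp_bounds.1.2.le
    d.exp_bounds.2.1.1.le d.exp_bounds.2.1.2.le d.exp_bounds.2.2.1 d.exp_bounds.2.2.2 d.hK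
  tendsto_atTop := fun x _ => tendsto_gK_atTop _ _ d.exp_bounds.1.2.le d.exp_bounds.2.1.2.le
    d.exp_bounds.2.2.2 x
  tendsto_atBot := fun y _ => tendsto_gK_atBot _ _ d.exp_bounds.1.2.le d.exp_bounds.2.1.2.le
    d.exp_bounds.2.2.2 y
  integrableOn_mid := integrableOn_gK_mid d.exp_bounds.1.1.le d.exp_bounds.1.2.le
    d.exp_bounds.2.1.1.le d.exp_bounds.2.1.2.le d.exp_bounds.2.2.1.le d.exp_bounds.2.2.2 d.hK
  integrableOn_edge := integrableOn_gK_edge d.mu d.exp_bounds.1.1 d.exp_bounds.2.1.1.le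
    d.exp_bounds.2.1.2.le d.exp_bounds.2.2.1 d.exp_bounds.2.2.2 d.hl_rel

/-- The datum's `g`. -/
theorem datum_g : d.datum.g = gK (cycExp d.N d.k) (cycExp d.N d.l) d.lam d.mu := rfl

/-! ## The pair trick -/

/-- `Im g(x) = 0` on the cut segment `(0, ½)` for the second-kind datum. -/
theorem im_datum_g_eq_zero : ∀ x ∈ Ioo (0 : ℝ) (1 / 2), (d.datum.g x).im = 0 := fun x hx =>
  im_gK_ofReal_pos _ _ hx.1 (by linarith [hx.2])

/-- **`[E⁻(k,l)] = [E⁻(l,k)]` in `Q` (second kind).** The swapped datum is the complex conjugate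
on the mid-line `x = ½` (same axis trace), both data have vanishing imaginary part on `(0, ½)`,
so Green's formula for the two data leaves only the negative half-line edges, which agree. -/
theorem mkQ_edgeNegPart_swap :
    mkQ (of d.datum.edgeNegPart) = mkQ (of d.swap.datum.edgeNegPart) := by
  have hmid : of d.swap.datum.midRep - of d.datum.midRep ∈ relations :=
    GreenDatum.midRep_congr _ _ fun y => by
      rw [datum_g, datum_g, swap_lam, swap_mu]
      exact re_gK_swap_half (cycExp d.N d.k) (cycExp d.N d.l) d.lam d.mu y
  have hedge : of d.datum.edgeRep - of d.swap.datum.edgeRep ∈ relations := by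
    have h := relations.sub_mem (relations.sub_mem d.swap.datum.midRep_sub_edgeRep
      d.datum.midRep_sub_edgeRep) hmid
    convert h using 1
    abel
  have h1 : of d.datum.edgeRep - of d.datum.edgeNegPart ∈ relations :=
    d.datum.edgeRep_sub_edgeNegPart fun x h0 h1 => d.im_datum_g_eq_zero x ⟨h0, h1⟩
  have h2 : of d.swap.datum.edgeRep - of d.swap.datum.edgeNegPart ∈ relations :=
    d.swap.datum.edgeRep_sub_edgeNegPart fun x h0 h1 => d.swap.im_datum_g_eq_zero x ⟨h0, h1⟩
  rw [mkQ_eq_mkQ_iff]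
  have h := relations.sub_mem (relations.add_mem hedge h2) h1
  convert h using 1
  abel

end SecData

end SoloBlind

end Summit.KontsevichZagierPeriods.KontsevichZagierPeriods.Theorems
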